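import Literature.AlgebraicGeometry.Motives.MixedHodgeStructureCatPureObjects
import Literature.AlgebraicGeometry.Motives.MixedHodgeStructureCatHodgeClasses
import Literature.AlgebraicGeometry.Motives.MixedHodgeStructureGradedPolarizable
import HarnessLib

/-!
# The graded-polarizable objects of `MixedHodgeStructureCat`: a class closed under subobjects and quotients, with semisimple `Gr^W`

Layer `Literature/AlgebraicGeometry/Motives` (lane `lit-hodgefound`).  Arapura §1: «Let `MHS` denote the category of rational mixed Hodge
structures, and `MHS^p` the full subcategory of polarizable Hodge structures. We note that mixed Hodge structures of geometric origin in fact lie in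
`MHS^p`, and the category of pure polarizable Hodge structures is semisimple.» … «subobjects and quotients of `H_1` are also polarizable».  Carlson
§2(a): «a polarization of `H` is a set of bilinear forms which polarize the graded pieces individually».  The tree proves the closure properties
UNBUNDLED (`MixedHodgeStructure.IsGradedPolarizable.of_injective`, `.of_surjective`, `.prod`, `.tateTwist`, `isGradedPolarizable_tate`,
`HodgeStructure.IsPolarizable.isGradedPolarizable_toMixedHodgeStructure`); this file states them for the category `MixedHodgeStructureCat` (g43-#3) as
an `ObjectProperty`:

* §1 **`isGradedPolarizable : ObjectProperty MixedHodgeStructureCat`** — FINITE-DIMENSIONAL and graded-polarizable (Arapura's `MHS^p`; the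
  finite-dimensionality is part of the property so that quotients stay inside); instances **`IsClosedUnderSubobjects`**, **`IsClosedUnderQuotients`**
  (hence `IsClosedUnderIsomorphisms`), **`ContainsZero`**; membership of the Tate objects `ℚ(j)` (`isGradedPolarizable_tateObj`) and of
  `ofPure n Y` for `Y` polarizable (`isGradedPolarizable_ofPure_obj`);
* §2 **`Gr^W_k` of a graded-polarizable object is a semisimple object of `HodgeStructureCat k`** (`isSemisimpleObj_gr_obj`) — the categorical form
  of «the category of pure polarizable Hodge structures is semisimple» (g43-#2 `HodgeStructureCat.isSemisimpleObj_of_isPolarizable`); a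
  graded-polarizable object with a single weight is semisimple in `MixedHodgeStructureCat` (`isSemisimpleObj_of_isPure`);
* §3 Arapura, Lemma 1.1 second and third items in functorial form: for a short exact `0 → X₁ → X₂ → X₃ → 0` with `X₂` graded-polarizable and
  `W_{2p-1} X₂ = 0`, **`0 → Hdgᵖ(X₁) → Hdgᵖ(X₂) → Hdgᵖ(X₃) → 0` is exact** (`hodgeClassesFunctor_map_shortExact_of_isGradedPolarizable`, from
  g43-#11); the auxiliary class `isGradedPolarizableOfWeightGE m` («polarizable of weight `≥ m`», `W_{m-1} = 0`) is again closed under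
  subobjects and quotients;
* §4 direct sums: `prodObj X Y` (the tree's `MixedHodgeStructure.prod`) with its projections is a binary PRODUCT in `MixedHodgeStructureCat`
  (`prodFanIsLimit`, `prodIsoProdObj : X ⨯ Y ≅ prodObj X Y`), so `isGradedPolarizable` is closed under binary and finite products
  (`IsClosedUnderBinaryProducts`, `IsClosedUnderFiniteProducts`, `isGradedPolarizable_biprod`).

Graded-polarizability is NOT closed under extensions (an extension of two polarizable Hodge structures of the same weight is pure of that
weight but need not be polarizable), so `isGradedPolarizable` is not a Serre class; no such claim is made.

Definitions with bodies (`isGradedPolarizable`, `isGradedPolarizableOfWeightGE`, `prodObj`, `prodFan`, `prodFanIsLimit`, `prodIsoProdObj`) and theorems; instances only of Mathlib's `ObjectProperty`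
closure classes on this file's own properties; no notion, no named fact (0 new facts), no notation.

## Sources, verbatim

* D. Arapura, *Hodge cycles and the Leray filtration*, Pacific J. Math. 319 (2022), §1 (held text arXiv 2103.05038 p0003 L3–L7, L23–L35,
  L44–L47): «`MHS^p` the full subcategory of polarizable Hodge structures … the category of pure polarizable Hodge structures is semisimple»;
  Lemma 1.1 «• `Hodge(−)` is an exact functor on the category of polarizable mixed Hodge structures of nonnegative weight. • If `H_1 → H_2 → H_3`
  is an exact sequence of mixed Hodge structures, such that `H_1` is polarizable with nonnegative weight, then `Hodge(H_1) → Hodge(H_2) →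
  Hodge(H_3)` is exact.»; proof: «subobjects and quotients of `H_1` are also polarizable with nonnegative weight».
* J. Carlson, *Extensions of mixed Hodge structures* (1980), §2(a) (graded polarizations).
* C. Voisin, *Hodge Theory and Complex Algebraic Geometry I* (2002), §7.3.1 Lemma 7.26 (complements of sub-Hodge structures under a polarization).

## References

* [Arapura2022] D. Arapura, Hodge cycles and the Leray filtration, Pacific J. Math. 319 (2022), §1 and Lemma 1.1.
* [Carlson1980] J. A. Carlson, Extensions of mixed Hodge structures, Journées de géométrie algébrique d'Angers 1979 (1980), §2(a).
* [VoisinHodgeI2002] C. Voisin, Hodge Theory and Complex Algebraic Geometry I (2002), §7.3.1 Lemma 7.26.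
* [Moonen2017FamiliesMotives] B. Moonen, Families of motives and the Mumford–Tate conjecture, Milan J. Math. 85 (2017), §2.1.
* [CattaniElZeinGriffithsLe2014] E. Cattani, F. El Zein, P. A. Griffiths, Lê D. T. (eds.), Hodge Theory, Math. Notes 49 (2014), Ex. 3.2.23 (2), Lemma 3.2.20.

## Provenance

Lane `lit-hodgefound` (summit `HodgeConjecture`), seat `lit-hodgefound-p36` (literature-prover, generation 43, row g43-#14).
-/

noncomputable section

open CategoryTheory CategoryTheory.Limits Literature.CategoryTheory.KrullSchmidt

namespace Literature.AlgebraicGeometry.Motives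

universe u

namespace MixedHodgeStructureCat

/-! ## §1 The class of graded-polarizable objects -/

/-- **Arapura's `MHS^p`**: the property of an object of `MixedHodgeStructureCat` of being finite-dimensional and GRADED-POLARIZABLE (every
`Gr^W_k` admits a polarization). [cite: Arapura2022, §1] [cite: Carlson1980, §2(a)] -/
def isGradedPolarizable : ObjectProperty MixedHodgeStructureCat.{u} := fun X => Module.Finite ℚ X ∧ X.str.IsGradedPolarizable

/-- Unfolding `isGradedPolarizable`. [cite: Arapura2022, §1] [cite: Carlson1980, §2(a)] -/
theorem isGradedPolarizable_iff (X : MixedHodgeStructureCat.{u}) : isGradedPolarizable X ↔ Module.Finite ℚ X ∧ X.str.IsGradedPolarizable := Iff.rfl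

/-- A graded-polarizable object is finite-dimensional. [cite: Arapura2022, §1] -/
theorem isGradedPolarizable.finite {X : MixedHodgeStructureCat.{u}} (h : isGradedPolarizable X) : Module.Finite ℚ X := h.1

/-- Each `Gr^W_k` of a graded-polarizable object is polarizable. [cite: Carlson1980, §2(a)] -/
theorem isGradedPolarizable.isPolarizable_gr {X : MixedHodgeStructureCat.{u}} (h : isGradedPolarizable X) (k : ℤ) : ((gr k).obj X).str.IsPolarizable :=
  h.2 k

/-- **Subobjects of graded-polarizable objects are graded-polarizable** («subobjects … of `H_1` are also polarizable»): a monomorphism is injective,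
and `Gr^W_k` of a sub-MHS is a sub-Hodge structure of `Gr^W_k`. [cite: Arapura2022, §1 Lemma 1.1 (proof)] -/
theorem isGradedPolarizable_of_mono {X Y : MixedHodgeStructureCat.{u}} (f : X ⟶ Y) [Mono f] (hY : isGradedPolarizable Y) : isGradedPolarizable X := by
  have hf : Function.Injective f.toLinearMap := (mono_iff_injective f).1 inferInstance
  haveI := hY.1
  exact ⟨Module.Finite.of_injective f.toLinearMap hf, hY.2.of_injective f hf⟩

/-- **Quotients of graded-polarizable objects are graded-polarizable** («… and quotients of `H_1` are also polarizable»): an epimorphism is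
surjective, and `Gr^W_k` of a quotient MHS is a quotient Hodge structure of `Gr^W_k`. [cite: Arapura2022, §1 Lemma 1.1 (proof)] -/
theorem isGradedPolarizable_of_epi {X Y : MixedHodgeStructureCat.{u}} (f : X ⟶ Y) [Epi f] (hX : isGradedPolarizable X) : isGradedPolarizable Y := by
  have hf : Function.Surjective f.toLinearMap := (epi_iff_surjective f).1 inferInstance
  haveI := hX.1
  exact ⟨Module.Finite.of_surjective f.toLinearMap hf, hX.2.of_surjective f hf⟩

/-- `isGradedPolarizable` is closed under subobjects. [cite: Arapura2022, §1 Lemma 1.1 (proof)] -/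
instance : isGradedPolarizable.{u}.IsClosedUnderSubobjects where
  prop_of_mono f _ hY := isGradedPolarizable_of_mono f hY

/-- `isGradedPolarizable` is closed under quotients. [cite: Arapura2022, §1 Lemma 1.1 (proof)] -/
instance : isGradedPolarizable.{u}.IsClosedUnderQuotients where
  prop_of_epi f _ hX := isGradedPolarizable_of_epi f hX

/-- `isGradedPolarizable` is invariant under isomorphisms. [cite: Arapura2022, §1] -/
theorem isGradedPolarizable_of_iso {X Y : MixedHodgeStructureCat.{u}} (e : X ≅ Y) (hX : isGradedPolarizable X) : isGradedPolarizable Y :=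
  isGradedPolarizable.prop_of_iso e hX

/-- **The Tate objects `ℚ(j)` are graded-polarizable.** [cite: Carlson1980, §2(a)] [cite: Arapura2022, §1] -/
theorem isGradedPolarizable_tateObj (j : ℤ) : isGradedPolarizable (tateObj.{u} j) := by
  refine ⟨?_, (HodgeStructure.isGradedPolarizable_tate j).comapEquiv _⟩
  change Module.Finite ℚ (ULift.{u} ℚ)
  infer_instance

/-- A zero object is graded-polarizable. [cite: Arapura2022, §1] -/
theorem isGradedPolarizable_of_isZero {X : MixedHodgeStructureCat.{u}} (hX : IsZero X) : isGradedPolarizable X := by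
  haveI : Subsingleton X := (isZero_iff_subsingleton X).1 hX
  haveI : Mono (hX.to_ (tateObj.{u} 0)) := (mono_iff_injective _).2 fun a b _ => Subsingleton.elim a b
  exact isGradedPolarizable_of_mono (hX.to_ (tateObj.{u} 0)) (isGradedPolarizable_tateObj 0)

/-- `isGradedPolarizable` contains a zero object. [cite: Arapura2022, §1] -/
instance : isGradedPolarizable.{u}.ContainsZero where
  exists_zero := ⟨zero, isZero_zero, isGradedPolarizable_of_isZero isZero_zero⟩

/-- **A polarizable (pure) Hodge structure is a graded-polarizable MHS**: `ofPure n Y` is graded-polarizable for `Y` polarizable and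
finite-dimensional. [cite: Carlson1980, §2(a)] [cite: Arapura2022, §1] -/
theorem isGradedPolarizable_ofPure_obj {n : ℤ} (Y : HodgeStructureCat.{u} n) [Module.Finite ℚ Y] (hY : Y.str.IsPolarizable) :
    isGradedPolarizable ((ofPure n).obj Y) :=
  ⟨‹Module.Finite ℚ Y›, hY.isGradedPolarizable_toMixedHodgeStructure⟩

/-! ## §2 Semisimplicity of the graded pieces -/

/-- **`Gr^W_k` of a graded-polarizable object is a semisimple object of `HodgeStructureCat k`** (a finite direct sum of irreducible Hodge
structures): «the category of pure polarizable Hodge structures is semisimple». [cite: Arapura2022, §1] [cite: VoisinHodgeI2002, §7.3.1 Lemma 7.26]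
[cite: Moonen2017FamiliesMotives, §2.1 (p. 3)] -/
theorem isSemisimpleObj_gr_obj {X : MixedHodgeStructureCat.{u}} (hX : isGradedPolarizable X) (k : ℤ) [HasFiniteBiproducts (HodgeStructureCat.{u} k)] :
    IsSemisimpleObj ((gr k).obj X) := by
  haveI := hX.1
  haveI : Module.Finite ℚ ((gr k).obj X) := Module.Finite.quotient ℚ _
  exact HodgeStructureCat.isSemisimpleObj_of_isPolarizable ((gr k).obj X) (hX.2 k)

/-- **A graded-polarizable object with a single weight `n` is a semisimple object of `MixedHodgeStructureCat`**: it is `ofPure n` of its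
polarizable `Gr^W_n` (g43-#8 `ofPureGrIso`, `isSemisimpleObj_ofPure_obj_of_isPolarizable`). [cite: Arapura2022, §1]
[cite: VoisinHodgeI2002, §7.3.1 Lemma 7.26] -/
theorem isSemisimpleObj_of_isPure [HasFiniteBiproducts MixedHodgeStructureCat.{u}] {X : MixedHodgeStructureCat.{u}} (hX : isGradedPolarizable X)
    {n : ℤ} (hn : X.str.IsPure n) : IsSemisimpleObj X := by
  haveI := hX.1
  haveI : Module.Finite ℚ ((gr n).obj X) := Module.Finite.quotient ℚ _
  exact (isSemisimpleObj_ofPure_obj_of_isPolarizable ((gr n).obj X) (hX.2 n)).of_iso (ofPureGrIso hn).symm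

/-! ## §3 Polarizable objects of weight `≥ m` and the exactness of `Hdgᵖ` -/

/-- **Arapura's «polarizable mixed Hodge structures of nonnegative weight»**, shifted: graded-polarizable objects with `W_{m-1} = 0` (all weights
`≥ m`; Arapura's class is `m = 0`, and for `Hdgᵖ = Hom(ℚ(-p), −)` the relevant one is `m = 2p`). [cite: Arapura2022, §1 Lemma 1.1] -/
def isGradedPolarizableOfWeightGE (m : ℤ) : ObjectProperty MixedHodgeStructureCat.{u} := fun X => isGradedPolarizable X ∧ X.str.W (m - 1) = ⊥

/-- Unfolding `isGradedPolarizableOfWeightGE`. [cite: Arapura2022, §1 Lemma 1.1] -/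
theorem isGradedPolarizableOfWeightGE_iff (m : ℤ) (X : MixedHodgeStructureCat.{u}) :
    isGradedPolarizableOfWeightGE m X ↔ isGradedPolarizable X ∧ X.str.W (m - 1) = ⊥ := Iff.rfl

/-- `W_k = 0` passes to subobjects (a monomorphism is injective and compatible with `W`). [cite: Arapura2022, §1 Lemma 1.1 (proof)] -/
theorem W_eq_bot_of_mono {X Y : MixedHodgeStructureCat.{u}} (f : X ⟶ Y) [Mono f] {k : ℤ} (hY : Y.str.W k = ⊥) : X.str.W k = ⊥ := by
  have hf : Function.Injective f.toLinearMap := (mono_iff_injective f).1 inferInstance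
  rw [eq_bot_iff]
  intro x hx
  have hx' : f.toLinearMap x ∈ Y.str.W k := f.map_W_le k ⟨x, hx, rfl⟩
  rw [hY, Submodule.mem_bot] at hx'
  exact (injective_iff_map_eq_zero f.toLinearMap).1 hf x hx'

/-- `W_k = 0` passes to quotients (`W_k Y = f(W_k X)` by strictness of an epimorphism). [cite: Arapura2022, §1 Lemma 1.1 (proof)]
[cite: CattaniElZeinGriffithsLe2014, Lemma 3.2.20] -/
theorem W_eq_bot_of_epi {X Y : MixedHodgeStructureCat.{u}} (f : X ⟶ Y) [Epi f] {k : ℤ} (hX : X.str.W k = ⊥) : Y.str.W k = ⊥ := by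
  have hr : LinearMap.range f.toLinearMap = ⊤ := LinearMap.range_eq_top.2 ((epi_iff_surjective f).1 inferInstance)
  rw [show Y.str.W k = (X.str.W k).map f.toLinearMap by rw [MixedHodgeStructure.Hom.map_W_eq, hr, inf_top_eq], hX, Submodule.map_bot]

/-- «Subobjects … of `H_1` are also polarizable with nonnegative weight.» [cite: Arapura2022, §1 Lemma 1.1 (proof)] -/
instance (m : ℤ) : (isGradedPolarizableOfWeightGE.{u} m).IsClosedUnderSubobjects where
  prop_of_mono f _ hY := ⟨isGradedPolarizable_of_mono f hY.1, W_eq_bot_of_mono f hY.2⟩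

/-- «… and quotients of `H_1` are also polarizable with nonnegative weight.» [cite: Arapura2022, §1 Lemma 1.1 (proof)] -/
instance (m : ℤ) : (isGradedPolarizableOfWeightGE.{u} m).IsClosedUnderQuotients where
  prop_of_epi f _ hX := ⟨isGradedPolarizable_of_epi f hX.1, W_eq_bot_of_epi f hX.2⟩

/-- The class contains a zero object. [cite: Arapura2022, §1 Lemma 1.1] -/
instance (m : ℤ) : (isGradedPolarizableOfWeightGE.{u} m).ContainsZero where
  exists_zero := ⟨zero, isZero_zero, isGradedPolarizable_of_isZero isZero_zero, by
    haveI : Subsingleton (zero.{u} : Type u) := (isZero_iff_subsingleton _).1 isZero_zero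
    exact Subsingleton.elim _ _⟩

/-- `ℚ(-p)` is polarizable of weight `≥ 2p`. [cite: Arapura2022, §1 Lemma 1.1] -/
theorem isGradedPolarizableOfWeightGE_tateObj (p : ℤ) : isGradedPolarizableOfWeightGE (2 * p) (tateObj.{u} (-p)) :=
  ⟨isGradedPolarizable_tateObj (-p), (isPure_tateObj (-p)).1 (2 * p - 1) (by omega)⟩

/-- **Arapura, Lemma 1.1, second item: `Hdgᵖ` is exact on polarizable MHS of weight `≥ 2p`.** For a short exact sequence
`0 → X₁ → X₂ → X₃ → 0` of `MixedHodgeStructureCat` whose middle term is graded-polarizable with `W_{2p-1} X₂ = 0`, the sequence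
`0 → Hdgᵖ(X₁) → Hdgᵖ(X₂) → Hdgᵖ(X₃) → 0` is exact (g43-#11 `hodgeClassesFunctor_map_shortExact`, whose hypotheses are exactly these).
[cite: Arapura2022, §1 Lemma 1.1] -/
theorem hodgeClassesFunctor_map_shortExact_of_isGradedPolarizable (p : ℤ) {S : ShortComplex MixedHodgeStructureCat.{u}} (hS : S.ShortExact)
    (h₂ : isGradedPolarizableOfWeightGE (2 * p) S.X₂) : (S.map (hodgeClassesFunctor p)).ShortExact := by
  haveI := h₂.1.1
  exact hodgeClassesFunctor_map_shortExact p hS h₂.2 (h₂.1.2 (2 * p))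

/-- **Arapura, Lemma 1.1, third item** (short-exact form): if `0 → X₁ → X₂ → X₃ → 0` is short exact and `X₁`, `X₃` — equivalently all three —
are polarizable of weight `≥ 2p` … here we record the version the tree proves: exactness at `Hdgᵖ(X₂)` and surjectivity of
`Hdgᵖ(X₂) → Hdgᵖ(X₃)` under the hypothesis on `X₂`. [cite: Arapura2022, §1 Lemma 1.1] -/
theorem epi_hodgeClassesFunctor_map_of_isGradedPolarizable (p : ℤ) {S : ShortComplex MixedHodgeStructureCat.{u}} (hS : S.ShortExact)
    (h₂ : isGradedPolarizableOfWeightGE (2 * p) S.X₂) : Epi ((hodgeClassesFunctor p).map S.g) :=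
  (hodgeClassesFunctor_map_shortExact_of_isGradedPolarizable p hS h₂).epi_g

/-! ## §4 Direct sums: binary products in `MixedHodgeStructureCat` and closure of `isGradedPolarizable` under finite products -/

/-- **The direct sum `X ⊕ Y` of two mixed Hodge structures as an object** (the tree's `MixedHodgeStructure.prod` on `X × Y`).
[cite: CattaniElZeinGriffithsLe2014, Ex. 3.2.23 (2)] -/
def prodObj (X Y : MixedHodgeStructureCat.{u}) : MixedHodgeStructureCat.{u} := of (X.str.prod Y.str)

/-- The binary fan `X ← X ⊕ Y → Y` of the two projections. [cite: CattaniElZeinGriffithsLe2014, Ex. 3.2.23 (2)] -/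
def prodFan (X Y : MixedHodgeStructureCat.{u}) : BinaryFan X Y :=
  BinaryFan.mk (P := prodObj X Y) (MixedHodgeStructure.Hom.fst X.str Y.str : prodObj X Y ⟶ X) (MixedHodgeStructure.Hom.snd X.str Y.str : prodObj X Y ⟶ Y)

/-- The projections of `prodFan` (by `rfl`). [cite: CattaniElZeinGriffithsLe2014, Ex. 3.2.23 (2)] -/
theorem prodFan_fst_toLinearMap (X Y : MixedHodgeStructureCat.{u}) : ((prodFan X Y).fst : prodObj X Y ⟶ X).toLinearMap = LinearMap.fst ℚ X Y := rfl

/-- The projections of `prodFan` (by `rfl`). [cite: CattaniElZeinGriffithsLe2014, Ex. 3.2.23 (2)] -/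
theorem prodFan_snd_toLinearMap (X Y : MixedHodgeStructureCat.{u}) : ((prodFan X Y).snd : prodObj X Y ⟶ Y).toLinearMap = LinearMap.snd ℚ X Y := rfl

/-- **`X ⊕ Y` with its projections is a product of `X` and `Y` in `MixedHodgeStructureCat`** (pairing `prodLift`). [cite: CattaniElZeinGriffithsLe2014, Ex. 3.2.23 (2)] -/
def prodFanIsLimit (X Y : MixedHodgeStructureCat.{u}) : IsLimit (prodFan X Y) :=
  BinaryFan.IsLimit.mk _ (fun f g => (MixedHodgeStructure.Hom.prodLift f g : _ ⟶ prodObj X Y))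
    (fun f g => MixedHodgeStructure.Hom.fst_comp_prodLift f g) (fun f g => MixedHodgeStructure.Hom.snd_comp_prodLift f g)
    (fun _ _ _ hf hg => MixedHodgeStructure.Hom.ext (LinearMap.ext fun x =>
      Prod.ext (congrArg (fun h : _ ⟶ X => h.toLinearMap x) hf) (congrArg (fun h : _ ⟶ Y => h.toLinearMap x) hg)))

/-- Hence **`X ⨯ Y ≅ X ⊕ Y`**: the categorical binary product is the direct sum. [cite: CattaniElZeinGriffithsLe2014, Ex. 3.2.23 (2)] -/
def prodIsoProdObj (X Y : MixedHodgeStructureCat.{u}) : X ⨯ Y ≅ prodObj X Y :=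
  (limit.isLimit (pair X Y)).conePointUniqueUpToIso (prodFanIsLimit X Y)

/-- **The direct sum of graded-polarizable objects is graded-polarizable** (`Gr^W_k(X ⊕ Y) ≅ Gr^W_k X ⊕ Gr^W_k Y` and an orthogonal sum of
polarizations polarizes; the tree's `IsGradedPolarizable.prod`). [cite: Carlson1980, §2(a)] [cite: CattaniElZeinGriffithsLe2014, Ex. 3.2.23 (2)] -/
theorem isGradedPolarizable_prodObj {X Y : MixedHodgeStructureCat.{u}} (hX : isGradedPolarizable X) (hY : isGradedPolarizable Y) :
    isGradedPolarizable (prodObj X Y) := by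
  haveI := hX.1
  haveI := hY.1
  exact ⟨(inferInstance : Module.Finite ℚ (X × Y)), hX.2.prod hY.2⟩

/-- `isGradedPolarizable` is closed under binary products. [cite: Carlson1980, §2(a)] [cite: Arapura2022, §1] -/
instance : isGradedPolarizable.{u}.IsClosedUnderBinaryProducts :=
  ObjectProperty.IsClosedUnderLimitsOfShape.mk' (by
    rintro _ ⟨F, hF⟩
    have hlim : IsLimit ((Cone.postcompose (diagramIsoPair F).inv).obj (prodFan (F.obj ⟨WalkingPair.left⟩) (F.obj ⟨WalkingPair.right⟩))) :=
      (IsLimit.postcomposeInvEquiv (diagramIsoPair F) _).symm (prodFanIsLimit _ _)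
    exact isGradedPolarizable_of_iso ((limit.isLimit F).conePointUniqueUpToIso hlim).symm
      (isGradedPolarizable_prodObj (hF ⟨WalkingPair.left⟩) (hF ⟨WalkingPair.right⟩)))

/-- **`isGradedPolarizable` is closed under finite products** (finite direct sums). [cite: Carlson1980, §2(a)] [cite: Arapura2022, §1] -/
instance : isGradedPolarizable.{u}.IsClosedUnderFiniteProducts := ObjectProperty.IsClosedUnderFiniteProducts.mk'

/-- In particular a biproduct `X ⊞ Y` of graded-polarizable objects is graded-polarizable. [cite: Carlson1980, §2(a)] [cite: Arapura2022, §1] -/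
theorem isGradedPolarizable_biprod {X Y : MixedHodgeStructureCat.{u}} [HasBinaryBiproduct X Y] (hX : isGradedPolarizable X) (hY : isGradedPolarizable Y) :
    isGradedPolarizable (X ⊞ Y) :=
  isGradedPolarizable_of_iso ((biprod.isoProd X Y).trans (prodIsoProdObj X Y)).symm (isGradedPolarizable_prodObj hX hY)

end MixedHodgeStructureCat

end Literature.AlgebraicGeometry.Motives

end
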